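import Literature.AlgebraicGeometry.HodgeTheory.WeilClassesSquareDivisorPolynomial
import HarnessLib

/-!
# The quadratic calculus of `f ↦ f^*θ` on `H²` of an abelian variety, and the `K`-symmetry lemma

Family `hodge`, layer `Literature/AlgebraicGeometry/HodgeTheory`. For homomorphisms `f, g : A ⟶ T` of complex abelian varieties and a
class `θ ∈ H²(T(ℂ); ℂ)`, the map `f ↦ f^*θ` is QUADRATIC: writing `B(f,g)θ := (f+g)^*θ - f^*θ - g^*θ` for its mixed term,

* `map_neg_two`: `(-f)^*θ = f^*θ`;  `map_nsmul_two`: `(n·f)^*θ = n²·f^*θ`;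
* `cross_apply_cupPowOne_two`: `B(f,g)(u ⌣ v) = f^*u ⌣ g^*v + g^*u ⌣ f^*v`;  `cross_add_left`, `cross_nsmul_left`, `cross_neg_left`:
  `B` is additive, `ℕ`-homogeneous and odd in its first argument (symmetric by `add_comm`);  `cross_comp_right` / `cross_comp_left`:
  `B(f ≫ α, g ≫ α)θ = B(f,g)(α^*θ)`, `B(p ≫ α, p ≫ β)θ = p^*(B(α,β)θ)`.

Everything follows from `H•(A(ℂ); ℂ) = ⋀•H¹` (the tree's `hasExteriorCohomologyH1_complexPoints`) and `(f+g)^* = f^* + g^*` on `H¹`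
(`complexBetti_map_add_deg_one`): both sides of each identity are linear in `θ` and agree on the products `u ⌣ v` of degree-one classes
(`exteriorPullback_ext`). This is the cohomological shadow of the theorem of the cube / of the quadraticity of `L ↦ φ_L`
(Lange–Birkenhake §2.3–2.4, Mumford §6 Cor. 3–4), folklore on the Betti side.

THE `K`-SYMMETRY LEMMA (`cross_id_eq_zero_of_KSymmetric`, `map_one_add_two_of_KSymmetric`): if `φ ≫ φ = -d` (`d ≥ 1`) and
`φ^*θ = d·θ` — the condition on a polarization whose Rosati involution induces complex conjugation on `K = ℚ(√-d)` (Deligne LNM 900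
(4.4); van Geemen Lemma 5.2: `E(φx, φy) = d·E(x,y)`, "`(√-d)^*` acts on `B¹` with eigenvalues `±d`") — then

  `B(𝟙, φ)θ = 0`, i.e. `(𝟙 + φ)^*θ = (1 + d)·θ`

("`θ` pairs `V₊` with `V₋` only"), proved WITHOUT eigenbases: with `x = B(𝟙,φ)θ`, `d·x = B(𝟙,φ)(φ^*θ) = ((𝟙+φ) ≫ φ)^*θ - dθ - d²θ` and
`((𝟙+φ) ≫ φ)^*θ = (-(d·𝟙) + φ)^*θ = d²θ + φ^*θ - d·x`, whence `2d·x = 0`. Consumer: `WeilClassesSquareKSymmetric` (the collapse of the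
B2b ladder's square generator to the packet's `P1`/`Ps` classes). All proved; no definition; no named fact.

## References

* [LangeBirkenhake1992] H. Lange, Ch. Birkenhake, Complex Abelian Varieties (1992), 1.1.2, Lemma 1.1.17, §2.3–2.4.
* [vanGeemen1994HodgeAV] B. van Geemen, LNM 1594 (1994), Lemma 5.2 and its proof.
* [Deligne1982HodgeCycles] P. Deligne, LNM 900 (1982), (4.4).
* [Hatcher2002] A. Hatcher, Algebraic Topology (2002), §3.2.
-/

noncomputable section

open CategoryTheory

namespace Literature.AlgebraicGeometry.HodgeTheory

open Literature.AlgebraicTopology.SingularHomology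
open Literature.AlgebraicGeometry.Motives

section HodgeTheory

variable {A T : Motives.AbelianVariety ℂ}

/-! ### §1 The quadratic calculus of `f ↦ f^*θ` on `H²` of an abelian variety -/

/-- On a generator `v₀ ⌣ v₁` of `H²(T)`: `f^*(v₀ ⌣ v₁) = f^*v₀ ⌣ f^*v₁`. [cite: Hatcher2002, §3.2 Prop. 3.10] -/
theorem map_cupPowOne_two (f : A ⟶ T) (v : Fin 2 → complexBetti T.X 1) :
    complexBetti.map f.hom.hom.hom 2 (cupPowOne ℂ (Motives.ComplexPoints T.X) 2 v) =
      cupProduct (Nat.add_comm 1 1) (complexBetti.map f.hom.hom.hom 1 (v 0)) (complexBetti.map f.hom.hom.hom 1 (v 1)) := by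
  rw [complexBetti_map_cupPowOne, cupPowOne_two]

/-- **`(-f)^*θ = f^*θ` on `H²`** (`(-f)^* = -f^*` on `H¹` and `(-u) ⌣ (-v) = u ⌣ v`). [cite: LangeBirkenhake1992, 1.1.2 and Lemma 1.1.17] -/
theorem map_neg_two (f : A ⟶ T) (θ : complexBetti T.X 2) :
    complexBetti.map (-f).hom.hom.hom 2 θ = complexBetti.map f.hom.hom.hom 2 θ := by
  have h : (complexBetti.map (-f).hom.hom.hom 2).hom = (complexBetti.map f.hom.hom.hom 2).hom := by
    refine exteriorPullback_ext (AbelianVariety.hasExteriorCohomologyH1_complexPoints T) fun v => ?_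
    change complexBetti.map (-f).hom.hom.hom 2 (cupPowOne ℂ _ 2 v) = complexBetti.map f.hom.hom.hom 2 (cupPowOne ℂ _ 2 v)
    rw [map_cupPowOne_two, map_cupPowOne_two, complexBetti_map_neg_deg_one, complexBetti_map_neg_deg_one, map_neg, map_neg,
      LinearMap.neg_apply, neg_neg]
  exact LinearMap.congr_fun h θ

/-- **`(n·f)^*θ = n²·f^*θ` on `H²`** (`n : ℕ`). [cite: LangeBirkenhake1992, 1.1.2 and Lemma 1.1.17] -/
theorem map_nsmul_two (n : ℕ) (f : A ⟶ T) (θ : complexBetti T.X 2) :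
    complexBetti.map (n • f).hom.hom.hom 2 θ = ((n : ℂ) ^ 2) • complexBetti.map f.hom.hom.hom 2 θ := by
  have h : (complexBetti.map (n • f).hom.hom.hom 2).hom = ((n : ℂ) ^ 2) • (complexBetti.map f.hom.hom.hom 2).hom := by
    refine exteriorPullback_ext (AbelianVariety.hasExteriorCohomologyH1_complexPoints T) fun v => ?_
    change complexBetti.map (n • f).hom.hom.hom 2 (cupPowOne ℂ _ 2 v) =
      ((n : ℂ) ^ 2) • complexBetti.map f.hom.hom.hom 2 (cupPowOne ℂ _ 2 v)
    rw [map_cupPowOne_two, map_cupPowOne_two, complexBetti_map_nsmul_deg_one, complexBetti_map_nsmul_deg_one,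
      ← Nat.cast_smul_eq_nsmul ℂ, ← Nat.cast_smul_eq_nsmul ℂ, map_smul, map_smul, LinearMap.smul_apply, smul_smul, pow_two]
  exact LinearMap.congr_fun h θ

/-- **The mixed term on generators: `B(f,g)(v₀ ⌣ v₁) = f^*v₀ ⌣ g^*v₁ + g^*v₀ ⌣ f^*v₁`**, `B(f,g)θ := (f+g)^*θ - f^*θ - g^*θ`.
[cite: LangeBirkenhake1992, 1.1.2 and Lemma 1.1.17] -/
theorem cross_apply_cupPowOne_two (f g : A ⟶ T) (v : Fin 2 → complexBetti T.X 1) :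
    complexBetti.map (f + g).hom.hom.hom 2 (cupPowOne ℂ (Motives.ComplexPoints T.X) 2 v) -
        complexBetti.map f.hom.hom.hom 2 (cupPowOne ℂ (Motives.ComplexPoints T.X) 2 v) -
        complexBetti.map g.hom.hom.hom 2 (cupPowOne ℂ (Motives.ComplexPoints T.X) 2 v) =
      cupProduct (Nat.add_comm 1 1) (complexBetti.map f.hom.hom.hom 1 (v 0)) (complexBetti.map g.hom.hom.hom 1 (v 1)) +
        cupProduct (Nat.add_comm 1 1) (complexBetti.map g.hom.hom.hom 1 (v 0)) (complexBetti.map f.hom.hom.hom 1 (v 1)) := by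
  rw [map_cupPowOne_two, map_cupPowOne_two, map_cupPowOne_two, complexBetti_map_add_deg_one, complexBetti_map_add_deg_one]
  simp only [map_add, LinearMap.add_apply]
  abel

/-- **The mixed term is additive in its first argument: `B(f + f', g)θ = B(f,g)θ + B(f',g)θ`.**
[cite: LangeBirkenhake1992, 1.1.2 and Lemma 1.1.17] -/
theorem cross_add_left (f f' g : A ⟶ T) (θ : complexBetti T.X 2) :
    complexBetti.map (f + f' + g).hom.hom.hom 2 θ - complexBetti.map (f + f').hom.hom.hom 2 θ - complexBetti.map g.hom.hom.hom 2 θ =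
      (complexBetti.map (f + g).hom.hom.hom 2 θ - complexBetti.map f.hom.hom.hom 2 θ - complexBetti.map g.hom.hom.hom 2 θ) +
        (complexBetti.map (f' + g).hom.hom.hom 2 θ - complexBetti.map f'.hom.hom.hom 2 θ - complexBetti.map g.hom.hom.hom 2 θ) := by
  have h : (complexBetti.map (f + f' + g).hom.hom.hom 2).hom - (complexBetti.map (f + f').hom.hom.hom 2).hom -
      (complexBetti.map g.hom.hom.hom 2).hom =
      ((complexBetti.map (f + g).hom.hom.hom 2).hom - (complexBetti.map f.hom.hom.hom 2).hom - (complexBetti.map g.hom.hom.hom 2).hom) +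
        ((complexBetti.map (f' + g).hom.hom.hom 2).hom - (complexBetti.map f'.hom.hom.hom 2).hom -
          (complexBetti.map g.hom.hom.hom 2).hom) := by
    refine exteriorPullback_ext (AbelianVariety.hasExteriorCohomologyH1_complexPoints T) fun v => ?_
    simp only [LinearMap.sub_apply, LinearMap.add_apply]
    change complexBetti.map (f + f' + g).hom.hom.hom 2 (cupPowOne ℂ _ 2 v) - complexBetti.map (f + f').hom.hom.hom 2 (cupPowOne ℂ _ 2 v) -
        complexBetti.map g.hom.hom.hom 2 (cupPowOne ℂ _ 2 v) =
      (complexBetti.map (f + g).hom.hom.hom 2 (cupPowOne ℂ _ 2 v) - complexBetti.map f.hom.hom.hom 2 (cupPowOne ℂ _ 2 v) -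
          complexBetti.map g.hom.hom.hom 2 (cupPowOne ℂ _ 2 v)) +
        (complexBetti.map (f' + g).hom.hom.hom 2 (cupPowOne ℂ _ 2 v) - complexBetti.map f'.hom.hom.hom 2 (cupPowOne ℂ _ 2 v) -
          complexBetti.map g.hom.hom.hom 2 (cupPowOne ℂ _ 2 v))
    rw [cross_apply_cupPowOne_two, cross_apply_cupPowOne_two, cross_apply_cupPowOne_two, complexBetti_map_add_deg_one,
      complexBetti_map_add_deg_one]
    simp only [map_add, LinearMap.add_apply]
    abel
  have := LinearMap.congr_fun h θ
  simpa only [LinearMap.sub_apply, LinearMap.add_apply] using this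

/-- **The mixed term is `ℕ`-homogeneous in its first argument: `B(n·f, g)θ = n·B(f,g)θ`.**
[cite: LangeBirkenhake1992, 1.1.2 and Lemma 1.1.17] -/
theorem cross_nsmul_left (n : ℕ) (f g : A ⟶ T) (θ : complexBetti T.X 2) :
    complexBetti.map (n • f + g).hom.hom.hom 2 θ - complexBetti.map (n • f).hom.hom.hom 2 θ - complexBetti.map g.hom.hom.hom 2 θ =
      (n : ℂ) • (complexBetti.map (f + g).hom.hom.hom 2 θ - complexBetti.map f.hom.hom.hom 2 θ - complexBetti.map g.hom.hom.hom 2 θ) := by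
  have h : (complexBetti.map (n • f + g).hom.hom.hom 2).hom - (complexBetti.map (n • f).hom.hom.hom 2).hom -
      (complexBetti.map g.hom.hom.hom 2).hom =
      (n : ℂ) • ((complexBetti.map (f + g).hom.hom.hom 2).hom - (complexBetti.map f.hom.hom.hom 2).hom -
        (complexBetti.map g.hom.hom.hom 2).hom) := by
    refine exteriorPullback_ext (AbelianVariety.hasExteriorCohomologyH1_complexPoints T) fun v => ?_
    simp only [LinearMap.sub_apply, LinearMap.smul_apply]
    change complexBetti.map (n • f + g).hom.hom.hom 2 (cupPowOne ℂ _ 2 v) - complexBetti.map (n • f).hom.hom.hom 2 (cupPowOne ℂ _ 2 v) -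
        complexBetti.map g.hom.hom.hom 2 (cupPowOne ℂ _ 2 v) =
      (n : ℂ) • (complexBetti.map (f + g).hom.hom.hom 2 (cupPowOne ℂ _ 2 v) - complexBetti.map f.hom.hom.hom 2 (cupPowOne ℂ _ 2 v) -
        complexBetti.map g.hom.hom.hom 2 (cupPowOne ℂ _ 2 v))
    rw [cross_apply_cupPowOne_two, cross_apply_cupPowOne_two, complexBetti_map_nsmul_deg_one, complexBetti_map_nsmul_deg_one,
      ← Nat.cast_smul_eq_nsmul ℂ, ← Nat.cast_smul_eq_nsmul ℂ]
    simp only [map_smul, LinearMap.smul_apply, smul_add]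
  have := LinearMap.congr_fun h θ
  simpa only [LinearMap.sub_apply, LinearMap.smul_apply] using this

/-- **The mixed term changes sign with its first argument: `B(-f, g)θ = -B(f,g)θ`.** [cite: LangeBirkenhake1992, 1.1.2 and Lemma 1.1.17] -/
theorem cross_neg_left (f g : A ⟶ T) (θ : complexBetti T.X 2) :
    complexBetti.map (-f + g).hom.hom.hom 2 θ - complexBetti.map (-f).hom.hom.hom 2 θ - complexBetti.map g.hom.hom.hom 2 θ =
      -(complexBetti.map (f + g).hom.hom.hom 2 θ - complexBetti.map f.hom.hom.hom 2 θ - complexBetti.map g.hom.hom.hom 2 θ) := by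
  have h : (complexBetti.map (-f + g).hom.hom.hom 2).hom - (complexBetti.map (-f).hom.hom.hom 2).hom -
      (complexBetti.map g.hom.hom.hom 2).hom =
      -((complexBetti.map (f + g).hom.hom.hom 2).hom - (complexBetti.map f.hom.hom.hom 2).hom -
        (complexBetti.map g.hom.hom.hom 2).hom) := by
    refine exteriorPullback_ext (AbelianVariety.hasExteriorCohomologyH1_complexPoints T) fun v => ?_
    simp only [LinearMap.sub_apply, LinearMap.neg_apply]
    change complexBetti.map (-f + g).hom.hom.hom 2 (cupPowOne ℂ _ 2 v) - complexBetti.map (-f).hom.hom.hom 2 (cupPowOne ℂ _ 2 v) -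
        complexBetti.map g.hom.hom.hom 2 (cupPowOne ℂ _ 2 v) =
      -(complexBetti.map (f + g).hom.hom.hom 2 (cupPowOne ℂ _ 2 v) - complexBetti.map f.hom.hom.hom 2 (cupPowOne ℂ _ 2 v) -
        complexBetti.map g.hom.hom.hom 2 (cupPowOne ℂ _ 2 v))
    rw [cross_apply_cupPowOne_two, cross_apply_cupPowOne_two, complexBetti_map_neg_deg_one, complexBetti_map_neg_deg_one]
    simp only [map_neg, LinearMap.neg_apply]
    abel
  have := LinearMap.congr_fun h θ
  simpa only [LinearMap.sub_apply, LinearMap.neg_apply] using this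

/-- **Naturality of the mixed term in `θ`: `B(f ≫ α, g ≫ α)θ = B(f,g)(α^*θ)`** (`f ≫ α + g ≫ α = (f+g) ≫ α`). [folklore] -/
theorem cross_comp_right (f g : A ⟶ T) (α : T ⟶ T) (θ : complexBetti T.X 2) :
    complexBetti.map (f ≫ α + g ≫ α).hom.hom.hom 2 θ - complexBetti.map (f ≫ α).hom.hom.hom 2 θ -
        complexBetti.map (g ≫ α).hom.hom.hom 2 θ =
      complexBetti.map (f + g).hom.hom.hom 2 (complexBetti.map α.hom.hom.hom 2 θ) -
        complexBetti.map f.hom.hom.hom 2 (complexBetti.map α.hom.hom.hom 2 θ) -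
        complexBetti.map g.hom.hom.hom 2 (complexBetti.map α.hom.hom.hom 2 θ) := by
  rw [← Preadditive.add_comp, complexBetti_map_map_hom, complexBetti_map_map_hom, complexBetti_map_map_hom]

/-- **Naturality of the mixed term in the source: `B(p ≫ α, p ≫ β)θ = p^*(B(α,β)θ)`** (`p ≫ α + p ≫ β = p ≫ (α+β)`). [folklore] -/
theorem cross_comp_left (p : A ⟶ T) (α β : T ⟶ T) (θ : complexBetti T.X 2) :
    complexBetti.map (p ≫ α + p ≫ β).hom.hom.hom 2 θ - complexBetti.map (p ≫ α).hom.hom.hom 2 θ -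
        complexBetti.map (p ≫ β).hom.hom.hom 2 θ =
      complexBetti.map p.hom.hom.hom 2 (complexBetti.map (α + β).hom.hom.hom 2 θ - complexBetti.map α.hom.hom.hom 2 θ -
        complexBetti.map β.hom.hom.hom 2 θ) := by
  rw [← Preadditive.comp_add, ← complexBetti_map_map_hom, ← complexBetti_map_map_hom, ← complexBetti_map_map_hom, map_sub, map_sub]

/-! ### §2 The `K`-symmetry lemma: `φ^*θ = dθ ⟹ (𝟙 + φ)^*θ = (1+d)θ` -/

variable {d : ℕ} {φ : T ⟶ T}

/-- `(𝟙 + φ) ≫ φ = -(d·𝟙) + φ` for `φ ≫ φ = -d`. [folklore] -/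
theorem one_add_comp_self_eq (hφ : φ ≫ φ = -(d • 𝟙 T)) : (𝟙 T + φ) ≫ φ = -(d • 𝟙 T) + φ := by
  rw [Preadditive.add_comp, Category.id_comp, hφ, add_comm]

/-- **The `K`-symmetry lemma.** If `φ ≫ φ = -d`, `d ≥ 1`, and `φ^*θ = d·θ` on `H²(T)`, then the mixed term `B(𝟙, φ)θ` vanishes:
`(𝟙 + φ)^*θ - θ - φ^*θ = 0` — i.e. `θ` pairs the two eigenspaces `V_±` of `φ^*` with each other only (van Geemen, proof of Lemma
5.2: on `B¹` the operator `(√-d)^*` has eigenvalues `±d`). Proof by the quadratic calculus, without eigenbases: with `x = B(𝟙,φ)θ` and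
`P = (𝟙+φ)^*θ`, the class `((𝟙+φ) ≫ φ)^*θ = (-(d·𝟙) + φ)^*θ` equals `d²θ + φ^*θ - d·x` (mixed term `B(-(d·𝟙), φ) = -d·B(𝟙, φ)`) and also
`(𝟙+φ)^*(φ^*θ) = d·P`; with `φ^*θ = dθ` this gives `2d·x = 0`. [cite: vanGeemen1994HodgeAV, proof of Lemma 5.2] [cite: Deligne1982HodgeCycles, (4.4)] -/
theorem cross_id_eq_zero_of_KSymmetric (hd : 0 < d) (hφ : φ ≫ φ = -(d • 𝟙 T)) {θ : complexBetti T.X 2}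
    (hθ : complexBetti.map φ.hom.hom.hom 2 θ = (d : ℂ) • θ) :
    complexBetti.map (𝟙 T + φ).hom.hom.hom 2 θ - θ - complexBetti.map φ.hom.hom.hom 2 θ = 0 := by
  have hid : complexBetti.map (𝟙 T : T ⟶ T).hom.hom.hom 2 θ = θ := abelianVariety_map_id_apply θ
  -- the mixed term `B(-(d·𝟙), φ)θ = -(d · B(𝟙, φ)θ)`
  have h1 := cross_neg_left (d • 𝟙 T) φ θ
  have h2 := cross_nsmul_left d (𝟙 T) φ θ
  rw [map_neg_two, map_nsmul_two, hid] at h1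
  rw [map_nsmul_two, hid] at h2
  rw [h2] at h1
  -- the second evaluation `((𝟙+φ)≫φ)^*θ = (𝟙+φ)^*(φ^*θ) = d · (𝟙+φ)^*θ`
  have h3 : complexBetti.map (-(d • 𝟙 T) + φ).hom.hom.hom 2 θ = (d : ℂ) • complexBetti.map (𝟙 T + φ).hom.hom.hom 2 θ := by
    rw [← one_add_comp_self_eq hφ, ← complexBetti_map_map_hom, hθ, map_smul]
  rw [h3, hθ] at h1
  -- `h1 : d·P - d²θ - dθ = -(d · (P - θ - dθ))`; conclude `2d · (P - θ - dθ) = 0`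
  rw [hθ]
  have key : ((2 : ℂ) * d) • (complexBetti.map (𝟙 T + φ).hom.hom.hom 2 θ - θ - (d : ℂ) • θ) =
      ((d : ℂ) • complexBetti.map (𝟙 T + φ).hom.hom.hom 2 θ - ((d : ℂ) ^ 2) • θ - (d : ℂ) • θ) +
        (d : ℂ) • (complexBetti.map (𝟙 T + φ).hom.hom.hom 2 θ - θ - (d : ℂ) • θ) := by
    module
  have h2dx : ((2 : ℂ) * d) • (complexBetti.map (𝟙 T + φ).hom.hom.hom 2 θ - θ - (d : ℂ) • θ) = 0 := by
    rw [key, h1, neg_add_cancel]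
  have hd0 : ((2 : ℂ) * d) ≠ 0 := mul_ne_zero two_ne_zero (by exact_mod_cast hd.ne')
  exact (smul_eq_zero.mp h2dx).resolve_left hd0

/-- **`(𝟙 + φ)^*θ = (1 + d)·θ`** for `φ ≫ φ = -d` and `K`-symmetric `θ`. [cite: vanGeemen1994HodgeAV, proof of Lemma 5.2] -/
theorem map_one_add_two_of_KSymmetric (hd : 0 < d) (hφ : φ ≫ φ = -(d • 𝟙 T)) {θ : complexBetti T.X 2}
    (hθ : complexBetti.map φ.hom.hom.hom 2 θ = (d : ℂ) • θ) :
    complexBetti.map (𝟙 T + φ).hom.hom.hom 2 θ = (1 + (d : ℂ)) • θ := by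
  have h := cross_id_eq_zero_of_KSymmetric hd hφ hθ
  rw [sub_sub, sub_eq_zero, hθ] at h
  rw [h, add_smul, one_smul]



end HodgeTheory

end Literature.AlgebraicGeometry.HodgeTheory

end
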